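import Literature.Probability.Percolation.CoveringStrictMonotonicity
import HarnessLib

/-!
# Strict monotonicity of `p_c^site` under quotients by free group actions (Martineau–Severo 2019, site version)

Topic `Literature/Probability/Percolation`. Named fact — the SITE-percolation reading of

* [MartineauSevero2019] S. Martineau, F. Severo, *Strict monotonicity of percolation thresholds under covering
  maps*, Ann. Probab. 47 (2019) 4116–4136, arXiv:1803.09686 — Corollary 2.2, together with the authors' standing
  remark that the results, stated for Bernoulli bond percolation, hold for site percolation: §2, Convention
  ("percolation is taken to mean Bernoulli bond percolation, but our proofs can be adapted to Bernoulli site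
  percolation"), §5 Remark 4 ("This construction adapts to site percolation …") and the last sentence of §6
  ("the proof above can be adapted to site percolation in a straightforward way").

The fact is DISCHARGED in the tree (`MartineauSevero2019_cor22_site_holds`, file
`SiteCoveringStrictMonotonicityHolds.lean`, the site twin of the inline bond proof
`MartineauSevero2019_cor22_holds`). It yields the strict inequality `p_c^site(ℤ³) < p_c^site(𝕋) ≤ 1/2` of
Campanino–Russo (Ann. Probab. 13 (1985)) through the quotient `ℤ³ → ℤ³/ℤ(1,1,1) ≅ 𝕋`, and the strict site slab
inequalities `p_c^site(ℤ^d) < p_c^site(ℤ^d[S_k])`.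

## The fact

`MartineauSevero2019_cor22_site`: for a countable, locally finite, connected graph `𝒢`, a nontrivial group `Γ`
acting FREELY on `V(𝒢)` by graph automorphisms, with `𝒢` and `𝒢/Γ` quasi-transitive and `p_c^site(𝒢) < 1`:
`p_c^site(𝒢) < p_c^site(𝒢/Γ)` (the tree's vertex-based `siteCriticalProb`, stated at a vertex `x` and its orbit;
`orbitQuotientGraph` is the quotient graph of `CoveringStrictMonotonicity.lean`).
-/

namespace Literature.Probability.Percolation

open Literature.Barriers.CriticalPhenomena (IsQuasiTransitive)

/-- **Martineau–Severo 2019, Corollary 2.2, for site percolation** (strict monotonicity of `p_c^site` under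
quotients by free actions). "Let `𝒢` be a graph. Let `G ≠ {1}` be a group acting on `V(𝒢)` by graph
automorphisms, and let `ℋ` denote the quotient graph `𝒢/G`. Assume that the following conditions hold: the
action `G ↷ V(𝒢)` is free; `𝒢` is quasi-transitive; `ℋ` is quasi-transitive; `p_c(𝒢) < 1`. Then one has
`p_c(𝒢) < p_c(ℋ)`", read for Bernoulli SITE percolation as the authors indicate (§2 Convention, §5 Remark 4,
end of §6). Stated with the tree's vertex-based `siteCriticalProb` at an arbitrary vertex `x` and its orbit.
[cite: MartineauSevero2019, Cor. 2.2 with §2 Convention and §5 Remark 4 (site percolation)] -/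
def MartineauSevero2019_cor22_site : Prop :=
  ∀ (V : Type) [Countable V] (G : SimpleGraph V) [G.LocallyFinite] (Γ : Type) [Group Γ]
    [MulAction Γ V],
    Nontrivial Γ →
    (∀ (g : Γ) (x y : V), G.Adj (g • x) (g • y) ↔ G.Adj x y) →
    (∀ (g : Γ) (x : V), g • x = x → g = 1) →
    G.Connected → IsQuasiTransitive G → IsQuasiTransitive (orbitQuotientGraph G Γ) →
    ∀ x : V, siteCriticalProb G x < 1 →
      siteCriticalProb G x < siteCriticalProb (orbitQuotientGraph G Γ) (Quotient.mk (MulAction.orbitRel Γ V) x)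

end Literature.Probability.Percolation
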